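import Summits.BirchSwinnertonDyer.BirchSwinnertonDyer.Theorems.CumulativeHeegnerLeopoldtEisensteinCharacterInvariantsAtThreeAlgLambdaOfCGLS
import Literature.NumberTheory.IwasawaTheory.Greenberg2006.CohomologyCofiniteGenerationDischarged
import HarnessLib

/-!
# Route `CumulativeHeegnerLeopoldt`, crux `EisensteinCharacterInvariantsAtThreeOdd` (stmt-BirchSwinnertonDyer-23970), line `birth` v11
# (skeleton 76d2d6d28fe42776): the registered 7-conjunction PRINT stub `stub_algLambdaPrintedFacts` needs only SIX named facts BY NAME —
# its seventh conjunct, Greenberg 2006 Prop. 3.2, is a TREE THEOREM (helper, `--supports stmt-BirchSwinnertonDyer-23970`)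

Prover `leafhand-bsd-cumulativeheegnerl-2` g0 (cell `bsd-eis`). The registered stub ALG-PRINT of crux 23970 is the conjunction of seven
Literature named facts: CGLS 2022 Prop. 1.2.5 (module clause), Cor. 1.2.6 (i), (ii); Greenberg 2016 Props. 4.1.1, 2.6.3; Greenberg 2006
Props. 4.1, 3.2. The LAST conjunct `Greenberg2006.prop32_cohomology_isCofinitelyGenerated` is PROVED on the tree
(`Greenberg2006.prop32_cohomology_isCofinitelyGenerated_holds`, Literature/…/Greenberg2006/CohomologyCofiniteGenerationDischarged.lean:
Prop. 3.2 ⟸ NSW (8.3.20) at every number field ⟸ base change to `K(ζ_q)` + the totally complex case, cell `bsd-eis` width seat x2-p2).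
Hence the registered stub's text is equivalent, in the kernel and with no hypothesis, to the conjunction of the remaining SIX facts:

* `stub_algLambdaPrintedFacts_of_six` — the registered 7-conjunction from the six unproved facts;
* `stub_algLambdaPrintedFacts_iff_six` — registered text ⟺ 6-conjunction.

Input-ledger reading for the LEAD / INPUTS desk (not a reshape; no registry verb is used): by-name print inputs of skeleton v11 of 23970 are
ALG-PRINT (7 → 6 names: prop125, cor126 (i), cor126 (ii), prop411, prop263, prop41) + KR-PRINT (3 names) + AN (= crux 24040); of the six,
only the three CGLS facts are load-bearing for the line (`…AlgLambdaOfCGLS.stub_algLambdaFormula_of_printedFacts`, p796221, uses conjuncts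
1–3 only), so a v12 reshape to 3 conjuncts remains the recommendation of record (leafhand-chl-1 g0 candidate file, evidence on 23970).

HONEST FRAMING: two bookkeeping theorems composing a tree theorem with hypotheses; no definition, no named fact introduced, no `sorry`;
the stub is NOT closed (six unproved published facts remain); item 23970 stays OPEN. BSD is not proved for any curve.
References: [Greenberg2006] Prop. 3.2; [NeukirchSchmidtWingberg2008] (8.3.20); [CastellaGrossiLeeSkinner2022] §1.2; [Greenberg2016] §2.6, §4.1.
-/

set_option linter.dupNamespace false
set_option autoImplicit false

noncomputable section

namespace Summit.BirchSwinnertonDyer.BirchSwinnertonDyer.Theorems.EisensteinCharacterInvariantsAtThreeOddAlgPrintOfSix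

open Literature.NumberTheory.EllipticCurves.CastellaGrossiLeeSkinner2022
  Literature.NumberTheory.IwasawaTheory.Greenberg2016 Literature.NumberTheory.IwasawaTheory.Greenberg2006

/-- **The registered PRINT stub `stub_algLambdaPrintedFacts` of crux 23970 (its 7-conjunction VERBATIM) from SIX named facts** —
the seventh conjunct, Greenberg 2006 Prop. 3.2, is supplied by the tree theorem `prop32_cohomology_isCofinitelyGenerated_holds`.
CONDITIONAL on six published facts typed as `Prop`s; closes nothing by name.
[cite: Greenberg2006, Prop. 3.2 (p. 358)] [cite: NeukirchSchmidtWingberg2008, (8.3.20)] -/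
theorem stub_algLambdaPrintedFacts_of_six
    (hprop125 : prop125_characterGrSelmerDual_torsion_muZero_dim)
    (hlift : cor126_residualCharacter_globalLift) (hlocal : cor126_residualCharacter_localSurjective)
    (h411 : prop411_selmer_isAlmostDivisible) (h263 : prop263_sur_of_crk) (h41 : prop41_globalEulerPoincareCorank) :
    Literature.NumberTheory.EllipticCurves.CastellaGrossiLeeSkinner2022.prop125_characterGrSelmerDual_torsion_muZero_dim ∧
      Literature.NumberTheory.EllipticCurves.CastellaGrossiLeeSkinner2022.cor126_residualCharacter_globalLift ∧
      Literature.NumberTheory.EllipticCurves.CastellaGrossiLeeSkinner2022.cor126_residualCharacter_localSurjective ∧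
      Literature.NumberTheory.IwasawaTheory.Greenberg2016.prop411_selmer_isAlmostDivisible ∧
      Literature.NumberTheory.IwasawaTheory.Greenberg2016.prop263_sur_of_crk ∧
      Literature.NumberTheory.IwasawaTheory.Greenberg2006.prop41_globalEulerPoincareCorank ∧
      Literature.NumberTheory.IwasawaTheory.Greenberg2006.prop32_cohomology_isCofinitelyGenerated :=
  ⟨hprop125, hlift, hlocal, h411, h263, h41, prop32_cohomology_isCofinitelyGenerated_holds⟩

/-- **Registered text of `stub_algLambdaPrintedFacts` ⟺ the conjunction of its SIX unproved conjuncts** (Greenberg 2006 Prop. 3.2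
being a tree theorem). Unconditional equivalence; closes nothing by name. [cite: Greenberg2006, Prop. 3.2 (p. 358)] -/
theorem stub_algLambdaPrintedFacts_iff_six :
    (Literature.NumberTheory.EllipticCurves.CastellaGrossiLeeSkinner2022.prop125_characterGrSelmerDual_torsion_muZero_dim ∧
      Literature.NumberTheory.EllipticCurves.CastellaGrossiLeeSkinner2022.cor126_residualCharacter_globalLift ∧
      Literature.NumberTheory.EllipticCurves.CastellaGrossiLeeSkinner2022.cor126_residualCharacter_localSurjective ∧
      Literature.NumberTheory.IwasawaTheory.Greenberg2016.prop411_selmer_isAlmostDivisible ∧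
      Literature.NumberTheory.IwasawaTheory.Greenberg2016.prop263_sur_of_crk ∧
      Literature.NumberTheory.IwasawaTheory.Greenberg2006.prop41_globalEulerPoincareCorank ∧
      Literature.NumberTheory.IwasawaTheory.Greenberg2006.prop32_cohomology_isCofinitelyGenerated) ↔
    (prop125_characterGrSelmerDual_torsion_muZero_dim ∧ cor126_residualCharacter_globalLift ∧
      cor126_residualCharacter_localSurjective ∧ prop411_selmer_isAlmostDivisible ∧ prop263_sur_of_crk ∧
      prop41_globalEulerPoincareCorank) :=
  ⟨fun h ↦ ⟨h.1, h.2.1, h.2.2.1, h.2.2.2.1, h.2.2.2.2.1, h.2.2.2.2.2.1⟩,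
    fun h ↦ stub_algLambdaPrintedFacts_of_six h.1 h.2.1 h.2.2.1 h.2.2.2.1 h.2.2.2.2.1 h.2.2.2.2.2⟩

end Summit.BirchSwinnertonDyer.BirchSwinnertonDyer.Theorems.EisensteinCharacterInvariantsAtThreeOddAlgPrintOfSix

end
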